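/-
Copyright (c) 2026 the pub-hodgecm-mathlib formalisation cell (harness21).  Prover seat hodgecm-mathlib-LH4-p11 (g9), req620 Track A «(D-RAM) FOUR-FRAME» squad, helper lane on
h413 = stmt-HodgeConjecture-24833 (count-neutral).  β-BOARD v1 (sub-dealer LH4-p05 (g8)), the TOWER-3 REST COLUMN for the assembler F0P3a-p01 (g37): the clean-shell dictionary of
the G₃ strata off the cancellation locus WITHOUT a cell or a guard, and the zero row it yields.  Pattern adapted from LH7-p06 (g0)'s ★ p861341 `shell_iff_of_mem_stratum_G3`.  2026-09-04.
-/
import Summits.HodgeConjecture.HodgeConjecture.Theorems.F0P3cDyRamLabelledOddKappaClassShellG3   -- ★ p861621 (this seat): `shell_of_mem_stratum_G3_kappaLocus`, `le_of_kappaLocus_G3`; brings ★ p861341∕p861424 (LH7-p06) level reads, ★ p861251 `stratum_G3_eq`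
import Summits.HodgeConjecture.HodgeConjecture.Theorems.F0P3cDyRamLabelledSplitStrata           -- ★ p859094 (F0P3a-p01): `finsum_mem_sep_eq_ite_of_forall_iff`
import Summits.HodgeConjecture.HodgeConjecture.Theorems.F0P3cDyRamLabelledOddCountDefs          -- ★ p860257 DEFS (LH4-p11 (g8)): `labelledOddCount`
import HarnessLib

/-!
# Crux `H413`, line LH4 «(D-RAM) FOUR-FRAME» — (β-BAL) Stage B, THE TOWER-3 REST COLUMN: the clean shell on `G₃(ρ, s) = (2ρ+s, 2ρ+s, 2ρ)` OFF THE CANCELLATION LOCUS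
# `n₃ ≠ n₂ + s`, with NO cell and NO guard — `shell ⟺ READ ∨ κ-LOCUS` — and the ZERO ROW off both

Cell `hodgecm-mathlib` (D-0151), FLOOR 0, crux item H413 = `stmt-HodgeConjecture-24833`, route `HCCMUnconditional`; squad F0∕P3c∕LH4.  THEOREMS ONLY (no `def`, no instance, no
notation, no `sorry`, default heartbeats); ★-only imports; lane `--supports stmt-HodgeConjecture-24833 --as helper` (count-neutral); pays NO row, states NO law.
WHAT.  Off the cancellation locus `n₃ ≠ n₂ + s` the level tokens of `X = diag(α−1, β−1, 0)` on the G₃ normal form are constant reads (★ `latticeInLevel_diagonal_latt_G3_iff_of_ne`):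
`X·M ⊆ ϖ^ℓ M ↔ ℓ ≤ n₂ ∧ ℓ ≤ n₁ ∧ ℓ + ρ + s ≤ n₃ ∧ ℓ + ρ ≤ n₁ ∧ ℓ + 2ρ ≤ n₂ ∧ ℓ + 2ρ + s ≤ n₃`, i.e. the X-level is `min(n₁ − ρ, n₂ − 2ρ, n₃ − 2ρ − s)`.  The clean shell
(`X`-level EXACTLY `ℓ₀ = d % 2`, square token at `mcOfRecord d`) is therefore met iff that minimum is `ℓ₀`; the branch `n₁ − ρ = ℓ₀` is void by the isosceles rule (`n₁ < n₂ ⇒ n₃ = n₁`),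
the square token is automatic in the other two (★ p861341's argument on the read, ★ p861621's on the κ-locus), so
* §1 HEAD **`shell_iff_of_mem_stratum_G3_offLocus`** (`ρ, s ≥ 1`, `mcOfRecord d ≤ N₀`, ANY `T`, `n₃ ≠ n₂ + s`): for every `M ∈ stratum σ ϖ T (2ρ+s, 2ρ+s, 2ρ)`,
  `shell M ↔ (2ρ + s + ℓ₀ = n₃ ∧ 2ρ + ℓ₀ + 1 ≤ n₂) ∨ (2ρ + ℓ₀ = n₂ ∧ 2ρ + s + ℓ₀ < n₃)` — the READ (the R2∕R5 tube classes; in the cell `2ρ + m* ≤ n₁` or under the guard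
  `2ρ + 2 + ℓ₀ ≤ min n₁ n₂` this is ★ `shell_iff_of_mem_stratum_G3{_of_guard}`) OR the κ-LOCUS (the R6 classes of the special tower 3; ★ `shell_of_mem_stratum_G3_kappaLocus`).
* §2 **`finsum_stratum_G3_shell_eq_zero_offLocus`** — off the locus, off the read and off the κ-locus the clean-shell cut of the stratum is EMPTY, so `Σᶠ_{cut} labelledOddCount∕w = 0` for
  ANY label `Λ`, ANY weight `w`, ANY slot: the tower-3 twin of LH7-p05 (g0)'s R7 «Theorem A» ∕ of the `hA` letter of ★ `restValue_G1_of_rows` (F0P3a-p01 (g37)).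
The ON-locus classes `n₃ = n₂ + s` (tower-3 glue) are NOT treated here.
HONEST LABEL.  Count-neutral (`--supports`); nothing printed is asserted; the tower-3 κ-class VALUE (R6, LH4-p08 (g10)), the tower-3 glue classes, hRest, (β) `stub_law_cleanSgn`, T₊ remain
OPEN; `HC_CM` is proved only modulo the 7 printed citations (2 remaining named inputs: hLiu418 = `stmt-HodgeConjecture-24832`, h413 = `stmt-HodgeConjecture-24833`) until rung 0 closes.
References: [Kottwitz1986BaseChangeUnits] §1 pp. 240–241 · [Rogawski1990] §4.9 Prop. 4.9.1 (a)(b) p. 55 · [Serre1980Trees] Ch. II §1.1.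
-/

set_option autoImplicit false

noncomputable section

namespace Summit.HodgeConjecture.HodgeConjecture.Cruxes.H413.F0P3cDyRamLabelledOddOffLocusShellG3

open Literature.NumberTheory.Automorphic Literature.NumberTheory.Automorphic.HermitianLattice
open Literature.NumberTheory.Automorphic.UnitaryLatticeTree Literature.NumberTheory.Automorphic.UnitaryThreeFourFrame
open Summit.HodgeConjecture.HodgeConjecture.Cruxes.H413.F0P3cDyRamFourFramePieces
open Summit.HodgeConjecture.HodgeConjecture.Cruxes.H413.F0P3cDyRamFourFrameCensusDefs
open Summit.HodgeConjecture.HodgeConjecture.Cruxes.H413.F0P3cDyRamStageOneBDefs (mcOfRecord)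
open Summit.HodgeConjecture.HodgeConjecture.Cruxes.H413.F0P3cDyRamDiagonalTorusDefs
open Summit.HodgeConjecture.HodgeConjecture.Cruxes.H413.F0P3cDyRamDiagonalStrataDefs
open Summit.HodgeConjecture.HodgeConjecture.Cruxes.H413.F0P3cDyRamLabelledOddCountDefs
open Summit.HodgeConjecture.HodgeConjecture.Cruxes.H413.F0P3cDyRamDiagonalGluedStratumG3 (stratum_G3_eq)
open Summit.HodgeConjecture.HodgeConjecture.Cruxes.H413.F0P3cDyRamLabelledOddPureStrataG3Shell (latticeInLevel_diagonal_latt_G3_iff latticeInLevel_diagonal_latt_G3_iff_of_ne)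
open Summit.HodgeConjecture.HodgeConjecture.Cruxes.H413.F0P3cDyRamLabelledSplitStrata (finsum_mem_sep_eq_ite_of_forall_iff)
open scoped Valued WithZero Matrix MatrixGroups

variable {K : Type} [Field K] [Valued K ℤᵐ⁰] {σ : K →+* K} {ϖ : K} {d t : ℕ} {α β : K} {N₀ n₁ n₂ n₃ : ℕ}

/-! ## §1  The clean shell off the cancellation locus: READ ∨ κ-LOCUS -/

/-- **THE CLEAN-SHELL DICTIONARY ON `G₃(ρ, s)` OFF THE CANCELLATION LOCUS** (`ρ, s ≥ 1`, `mcOfRecord d ≤ N₀`, ANY `T`; `n₃ ≠ n₂ + s`): for every member of the stratum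
`(2ρ+s, 2ρ+s, 2ρ)`, the three shell tokens of `X = diag(α−1, β−1, 0)` hold iff `(2ρ + s + ℓ₀ = n₃ ∧ 2ρ + ℓ₀ + 1 ≤ n₂)` (the READ) `∨ (2ρ + ℓ₀ = n₂ ∧ 2ρ + s + ℓ₀ < n₃)` (the κ-LOCUS)
— the X-level `min(n₁ − ρ, n₂ − 2ρ, n₃ − 2ρ − s)` is `ℓ₀` exactly in these two ways only (the `n₁`-branch is void by the isosceles rule), the square token being automatic in both.
No cell, no guard. [cite: Kottwitz1986BaseChangeUnits, §1 pp. 240–241] [cite: Rogawski1990, §4.9 Prop. 4.9.1 (a) p. 55] [cite: Serre1980Trees, Ch. II §1.1] -/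
theorem shell_iff_of_mem_stratum_G3_offLocus (hD : IsRamifiedQuadraticDatum σ ϖ d t)
    (hE : IsElementDatum σ ϖ N₀ α β n₁ n₂ n₃) (hmc : mcOfRecord d ≤ N₀)
    (T : GL (Fin 3) K) (ρ s : ℕ) (hρ : 1 ≤ ρ) (hs : 1 ≤ s) (hloc : n₃ ≠ n₂ + s) :
    ∀ M ∈ stratum σ ϖ T ![2 * ρ + s, 2 * ρ + s, 2 * ρ],
      (LatticeInLevel ϖ (d % 2) (Matrix.diagonal ![α - 1, β - 1, 0]) M ∧ ¬ LatticeInLevel ϖ (d % 2 + 1) (Matrix.diagonal ![α - 1, β - 1, 0]) M ∧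
          LatticeInLevel ϖ (mcOfRecord d) (Matrix.diagonal ![(α - 1) * (α - 1), (β - 1) * (β - 1), 0]) M) ↔
        (2 * ρ + s + d % 2 = n₃ ∧ 2 * ρ + d % 2 + 1 ≤ n₂) ∨ (2 * ρ + d % 2 = n₂ ∧ 2 * ρ + s + d % 2 < n₃) := by
  classical
  have hD' := hD
  obtain ⟨hσ, hvσ, hϖ, hfix, -, -, -⟩ := hD'
  have hϖ0 : ϖ ≠ 0 := fun h0 => by rw [h0, map_zero] at hϖ; exact WithZero.coe_ne_zero hϖ.symm
  have hα : Valued.v (α - 1) = Valued.v ϖ ^ n₂ := hE.2.2.2.2.2.2.1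
  have hβ : Valued.v (β - 1) = Valued.v ϖ ^ n₁ := hE.2.2.2.2.2.1
  have hγ : Valued.v (α - β) = Valued.v ϖ ^ n₃ := hE.2.2.2.2.2.2.2.1
  have hn₁ : N₀ ≤ n₁ := hE.2.2.2.2.2.2.2.2.1
  have hn₂ : N₀ ≤ n₂ := hE.2.2.2.2.2.2.2.2.2.1
  have hn₃ : N₀ ≤ n₃ := hE.2.2.2.2.2.2.2.2.2.2
  have hmcv : mcOfRecord d = 2 * ((d % 2 + 2 * d - 1 + d) / 2) := rfl
  rw [hmcv] at hmc ⊢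
  have hq : ∀ n : ℕ, Valued.v ϖ ^ n = WithZero.exp (-(n : ℤ)) := fun n => by
    rw [hϖ, ← WithZero.exp_nsmul]; congr 1; simp
  have hpw : ∀ a b : ℕ, Valued.v ϖ ^ a ≤ Valued.v ϖ ^ b ↔ b ≤ a := fun a b => by rw [hq, hq, WithZero.exp_le_exp]; omega
  have hpwlt : ∀ a b : ℕ, Valued.v ϖ ^ a < Valued.v ϖ ^ b ↔ b < a := fun a b => by rw [hq, hq, WithZero.exp_lt_exp]; omega
  have hpweq : ∀ a b : ℕ, Valued.v ϖ ^ a = Valued.v ϖ ^ b ↔ a = b := fun a b => by rw [hq, hq, WithZero.exp_inj]; omega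
  have hv0 : ∀ k : ℕ, Valued.v (0 : K) ≤ Valued.v ϖ ^ k := fun k => by rw [map_zero]; exact zero_le
  have hγ' : Valued.v (β - 1 - (α - 1)) = Valued.v ϖ ^ n₃ := by rw [show β - 1 - (α - 1) = -(α - β) by ring, Valuation.map_neg, hγ]
  have hγ'' : Valued.v (α - 1 - (β - 1)) = Valued.v ϖ ^ n₃ := by rw [show α - 1 - (β - 1) = α - β by ring, hγ]
  have hA2 : Valued.v ((α - 1) * (α - 1)) = Valued.v ϖ ^ (2 * n₂) := by rw [map_mul, hα, ← pow_add, two_mul]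
  have hB2 : Valued.v ((β - 1) * (β - 1)) = Valued.v ϖ ^ (2 * n₁) := by rw [map_mul, hβ, ← pow_add, two_mul]
  -- the isosceles rule of the root depths
  have hiso₁ : n₁ < n₂ → n₃ = n₁ := fun h => by
    have hlt' : Valued.v (α - 1) < Valued.v (β - 1) := by rw [hα, hβ, hpwlt]; exact h
    have e := Valuation.map_sub_eq_of_lt_left _ hlt'
    rw [hγ', hβ, hpweq] at e
    exact e
  have hiso₂ : n₂ < n₁ → n₃ = n₂ := fun h => by
    have hlt' : Valued.v (β - 1) < Valued.v (α - 1) := by rw [hα, hβ, hpwlt]; exact h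
    have e := Valuation.map_sub_eq_of_lt_left _ hlt'
    rw [hγ'', hα, hpweq] at e
    exact e
  have hsqdiff : Valued.v ((α - 1) * (α - 1) - (β - 1) * (β - 1)) ≤ Valued.v ϖ ^ (n₃ + min n₁ n₂) := by
    rw [show (α - 1) * (α - 1) - (β - 1) * (β - 1) = (α - β) * ((α - 1) + (β - 1)) by ring, map_mul, hγ, pow_add]
    refine mul_le_mul' le_rfl ((Valuation.map_add _ _ _).trans (max_le ?_ ?_))
    · rw [hα, hpw]; exact min_le_right _ _
    · rw [hβ, hpw]; exact min_le_left _ _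
  intro M hM
  rw [stratum_G3_eq hvσ hfix hϖ T hρ hs] at hM
  obtain ⟨x, y, z, hx, hy, hz, rfl, -, -⟩ := hM
  -- THE SQUARE TOKEN from `2ρ ≤ n₂`, `ρ ≤ n₁`, `mc + 2ρ + s ≤ n₃ + min n₁ n₂`
  have hsq : 2 * ρ ≤ n₂ → ρ ≤ n₁ → 2 * ((d % 2 + 2 * d - 1 + d) / 2) + 2 * ρ + s ≤ n₃ + min n₁ n₂ →
      LatticeInLevel ϖ (2 * ((d % 2 + 2 * d - 1 + d) / 2)) (Matrix.diagonal ![(α - 1) * (α - 1), (β - 1) * (β - 1), 0])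
        (latt (!![1, 0, 0; x, ϖ ^ (ρ + s), 0; y, z, ϖ ^ (2 * ρ)] : Matrix (Fin 3) (Fin 3) K)) := fun h2 h1 h3 => by
    rw [latticeInLevel_diagonal_latt_G3_iff hϖ0 _ ρ s _ hx y hz]
    simp only [Matrix.cons_val_zero, Matrix.cons_val_one, Matrix.cons_val_two, Matrix.tail_cons, Matrix.head_cons, zero_sub, Valuation.map_neg]
    have hmin₁ : min n₁ n₂ ≤ n₁ := min_le_left _ _
    have hmin₂ : min n₁ n₂ ≤ n₂ := min_le_right _ _
    refine ⟨⟨?_, ?_, hv0 _⟩, ?_, ?_, ?_⟩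
    · rw [hA2, hpw]; omega
    · rw [hB2, hpw]; omega
    · rw [show (β - 1) * (β - 1) - (α - 1) * (α - 1) = -((α - 1) * (α - 1) - (β - 1) * (β - 1)) by ring, Valuation.map_neg]
      refine hsqdiff.trans ?_
      rw [hpw]; omega
    · rw [hB2, hpw]; omega
    · refine (Valuation.map_add _ _ _).trans (max_le ?_ ?_)
      · rw [map_mul, map_mul, Valuation.map_neg, hA2, hy, mul_one, map_pow, ← pow_add, hpw]; omega
      · rw [map_mul, map_mul, hx, mul_one, hz, map_pow]
        refine (mul_le_mul' hsqdiff le_rfl).trans ?_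
        rw [← pow_add, hpw]; omega
  -- the constant level reads off the locus
  have hne : Valued.v ((![α - 1, β - 1, 0] : Fin 3 → K) 2 - (![α - 1, β - 1, 0] : Fin 3 → K) 0) * Valued.v ϖ ^ s ≠
      Valued.v ((![α - 1, β - 1, 0] : Fin 3 → K) 0 - (![α - 1, β - 1, 0] : Fin 3 → K) 1) := by
    simp only [Matrix.cons_val_zero, Matrix.cons_val_one, Matrix.cons_val_two, Matrix.tail_cons, Matrix.head_cons, zero_sub, Valuation.map_neg, hα, hγ'', ← pow_add]
    rw [Ne, hpweq]; omega
  have htok : ∀ ℓ : ℕ, LatticeInLevel ϖ ℓ (Matrix.diagonal ![α - 1, β - 1, 0])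
      (latt (!![1, 0, 0; x, ϖ ^ (ρ + s), 0; y, z, ϖ ^ (2 * ρ)] : Matrix (Fin 3) (Fin 3) K)) ↔
        (ℓ ≤ n₂ ∧ ℓ ≤ n₁) ∧ ℓ + ρ + s ≤ n₃ ∧ ℓ + ρ ≤ n₁ ∧ (ℓ + 2 * ρ ≤ n₂ ∧ ℓ + 2 * ρ + s ≤ n₃) := fun ℓ => by
    rw [latticeInLevel_diagonal_latt_G3_iff_of_ne hϖ0 ℓ ρ s _ hx hy hz hne]
    simp only [Matrix.cons_val_zero, Matrix.cons_val_one, Matrix.cons_val_two, Matrix.tail_cons, Matrix.head_cons, zero_sub, Valuation.map_neg, hv0, and_true,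
      hα, hβ, hγ', hγ'', hpw]
  rw [htok, htok]
  constructor
  · rintro ⟨⟨⟨-, -⟩, h3, h1, h2, h3'⟩, hnot, -⟩
    -- the X-level is exactly `ℓ₀`: one of the three depths is attained; the `n₁`-branch is void
    by_cases hb : 2 * ρ + d % 2 = n₂
    · right; exact ⟨hb, by omega⟩
    · left
      by_cases ha : 2 * ρ + s + d % 2 = n₃
      · exact ⟨ha, by omega⟩
      · exfalso
        have hn1 : n₁ = ρ + d % 2 := by
          by_contra hc
          exact hnot ⟨⟨by omega, by omega⟩, by omega, by omega, by omega, by omega⟩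
        have := hiso₁ (by omega)
        omega
  · rintro (⟨ha, hb⟩ | ⟨hb, ha⟩)
    · -- on the READ: `n₂ ≥ 2ρ + ℓ₀ + 1`; isosceles gives `n₁ ≥ ρ + ℓ₀`
      have hn1 : ρ + d % 2 ≤ n₁ := by
        by_contra hc
        have := hiso₁ (by omega)
        omega
      refine ⟨⟨⟨by omega, by omega⟩, by omega, by omega, by omega, by omega⟩, fun h => by omega, hsq (by omega) (by omega) ?_⟩
      have : N₀ ≤ min n₁ n₂ := le_min hn₁ hn₂
      omega
    · -- on the κ-LOCUS: ★ p861621's letters (`n₂ ≤ n₁`)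
      obtain ⟨h21, -⟩ := F0P3cDyRamLabelledOddKappaClassShellG3.le_of_kappaLocus_G3 hD hE ρ s hb ha
      refine ⟨⟨⟨by omega, by omega⟩, by omega, by omega, by omega, by omega⟩, fun h => by omega, hsq (by omega) (by omega) ?_⟩
      have : min n₁ n₂ = n₂ := min_eq_right h21
      omega

/-! ## §2  The zero row off the locus, off the read, off the κ-locus -/

/-- **THE TOWER-3 ZERO ROW OFF THE LOCUS**: for `ρ, s ≥ 1`, `mcOfRecord d ≤ N₀`, ANY `T`, off the cancellation locus `n₃ ≠ n₂ + s`, off the read `¬(2ρ + s + ℓ₀ = n₃ ∧ 2ρ + ℓ₀ + 1 ≤ n₂)` and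
off the κ-locus `¬(2ρ + ℓ₀ = n₂ ∧ 2ρ + s + ℓ₀ < n₃)`, the clean-shell cut of the stratum `(2ρ+s, 2ρ+s, 2ρ)` carries `Σᶠ labelledOddCount σ ϖ 0 i Λ M ∕ w M = 0` for ANY label and weight
(the cut is empty).  The tower-3 twin of the `hA` letter of ★ `restValue_G1_of_rows`. [cite: Kottwitz1986BaseChangeUnits, §1 pp. 240–241] [cite: Rogawski1990, §4.9 Prop. 4.9.1 (a) p. 55] -/
theorem finsum_stratum_G3_shell_eq_zero_offLocus (hD : IsRamifiedQuadraticDatum σ ϖ d t)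
    (hE : IsElementDatum σ ϖ N₀ α β n₁ n₂ n₃) (hmc : mcOfRecord d ≤ N₀)
    (T : GL (Fin 3) K) (ρ s : ℕ) (hρ : 1 ≤ ρ) (hs : 1 ≤ s) (hloc : n₃ ≠ n₂ + s)
    (hnread : ¬ (2 * ρ + s + d % 2 = n₃ ∧ 2 * ρ + d % 2 + 1 ≤ n₂)) (hnκ : ¬ (2 * ρ + d % 2 = n₂ ∧ 2 * ρ + s + d % 2 < n₃))
    (Λ : Submodule 𝒪[K] (Fin 3 → K) → (Fin 3 → K) → Prop) (w : Submodule 𝒪[K] (Fin 3 → K) → ℚ) (i : Fin 3) :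
    ∑ᶠ M ∈ {M : Submodule 𝒪[K] (Fin 3 → K) | M ∈ stratum σ ϖ T ![2 * ρ + s, 2 * ρ + s, 2 * ρ] ∧
        (LatticeInLevel ϖ (d % 2) (Matrix.diagonal ![α - 1, β - 1, 0]) M ∧ ¬ LatticeInLevel ϖ (d % 2 + 1) (Matrix.diagonal ![α - 1, β - 1, 0]) M ∧
          LatticeInLevel ϖ (mcOfRecord d) (Matrix.diagonal ![(α - 1) * (α - 1), (β - 1) * (β - 1), 0]) M)},
      (labelledOddCount σ ϖ 0 i Λ M : ℚ) / w M = 0 := by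
  classical
  rw [finsum_mem_sep_eq_ite_of_forall_iff (stratum σ ϖ T ![2 * ρ + s, 2 * ρ + s, 2 * ρ]) _ _
    (shell_iff_of_mem_stratum_G3_offLocus hD hE hmc T ρ s hρ hs hloc), if_neg (not_or.2 ⟨hnread, hnκ⟩)]

end Summit.HodgeConjecture.HodgeConjecture.Cruxes.H413.F0P3cDyRamLabelledOddOffLocusShellG3

end
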